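import Literature.Dynamics.SymbolicDynamics.DistortionSkeleton
import Mathlib.Tactic.Linarith
import Mathlib.Tactic.Ring
import HarnessLib

/-!
# Following curves through explicit regions of the distortion layer

Curve-tracking lemmas for the gluing construction (Gangloff–Sablik Prop. 31–32): a curve of an
admissible configuration `z` (`IsDelta`, `DistortionLayer.lean`) followed to the right
(`succPerm`)

* only depends on the `↓`-cells of a triangle-shaped region to its lower right
  (`succPerm_pow_local`), and drops by at most one row per column (`succPerm_pow_row_bounds`);
* stays level through columns with no `↓` on its row (`succPerm_pow_level`);
* crossing a **window of parallel climbing chains** (columns `a … a+H` in which the `↓`-cells are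
  exactly the diagonals `(a + s, r + s)`, `r ∈ F`) drops by exactly the number of chains that
  started below it, provided the window is long enough (`succPerm_pow_window`): in the diagonal
  coordinate `d = row - s` the curve descends one unit per column and skips the elements of `F`;
* and in a column, the `→`-cell `b` places above `c` is reached by `nxtPerm ^ b`, where the
  number of `→`-cells strictly between is the row distance minus the number of `↓` between
  (`nxtPerm_pow_eq_of_count`); powers of `nxtPerm` are injective (`nxtPerm_zpow_injective`).

## References

* S. Gangloff, M. Sablik, *Quantified block gluing for multidimensional subshifts of finite type:
  aperiodicity and entropy*, J. Anal. Math. 144 (2021), §5.4.2, proofs of Props. 31–32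
  (arXiv:1706.01627).
-/

namespace Literature.Dynamics.SymbolicDynamics.Distortion

variable {A B : Type*} {z : ℤ × ℤ → Option A}

/-! ### Row bounds and locality -/

/-- Following a curve `s` columns to the right lands in column `col + s`, at most `s` rows lower.
[cite: GangloffSablik2021, §5.4.1 (arXiv numbering)] -/
theorem succPerm_pow_row_bounds (hz : IsDelta z) (c : RC z) (s : ℕ) :
    ((succPerm hz ^ s) c).1.1 = c.1.1 + s ∧ c.1.2 - s ≤ ((succPerm hz ^ s) c).1.2 ∧
      ((succPerm hz ^ s) c).1.2 ≤ c.1.2 := by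
  induction s with
  | zero => simp
  | succ s ih =>
    obtain ⟨h1, h2, h3⟩ := ih
    rw [pow_succ', Equiv.Perm.mul_apply, succPerm_apply]
    have hc := succFun_col hz ((succPerm hz ^ s) c)
    rw [Nat.cast_succ]
    rcases succFun_row hz ((succPerm hz ^ s) c) with hr | hr
    · exact ⟨by rw [hc, h1]; ring, by omega, by omega⟩
    · exact ⟨by rw [hc, h1]; ring, by omega, by omega⟩

/-- **Locality**: two admissible configurations whose `↓`-cells agree on the cells
`(col + t, row - j)`, `1 ≤ t ≤ m`, `0 ≤ j ≤ m`, have the same curve through `(col, row)` for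
`m` columns. [cite: GangloffSablik2021, §5.4.2 (arXiv numbering)] -/
theorem succPerm_pow_local {z' : ℤ × ℤ → Option B} (hz : IsDelta z) (hz' : IsDelta z')
    (c : RC z) (c' : RC z') (hcc : c'.1 = c.1) (m : ℕ)
    (hag : ∀ t j : ℤ, c.1.1 < t → t ≤ c.1.1 + m → c.1.2 - m ≤ j → j ≤ c.1.2 →
      (z (t, j) = none ↔ z' (t, j) = none)) :
    ∀ s : ℕ, s ≤ m → ((succPerm hz' ^ s) c').1 = ((succPerm hz ^ s) c).1 := by
  intro s
  induction s with
  | zero => intro; simpa using hcc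
  | succ s ih =>
    intro hs
    have he := ih (by omega)
    obtain ⟨h1, h2, h3⟩ := succPerm_pow_row_bounds hz c s
    rw [pow_succ', pow_succ', Equiv.Perm.mul_apply, Equiv.Perm.mul_apply, succPerm_apply,
      succPerm_apply]
    set e := (succPerm hz ^ s) c
    set e' := (succPerm hz' ^ s) c'
    have key := hag (e.1.1 + 1) e.1.2 (by omega) (by omega) (by omega) h3
    by_cases hn : z (e.1.1 + 1, e.1.2) = none
    · rw [succFun_val_of_eq_none hz e hn, succFun_val_of_eq_none hz' e' (by rw [he]; exact key.mp hn),
        he]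
    · rw [succFun_val_of_ne_none hz e hn,
        succFun_val_of_ne_none hz' e' (by rw [he]; exact fun h => hn (key.mpr h)), he]

/-! ### Level regions -/

/-- **A curve with no `↓` ahead of it on its row stays level.**
[cite: GangloffSablik2021, §5.4.2 (arXiv numbering), proof of Prop. 31 ("straight")] -/
theorem succPerm_pow_level (hz : IsDelta z) (c : RC z) (m : ℕ)
    (h : ∀ t : ℤ, c.1.1 < t → t ≤ c.1.1 + m → z (t, c.1.2) ≠ none) :
    ∀ s : ℕ, s ≤ m → ((succPerm hz ^ s) c).1 = (c.1.1 + s, c.1.2) := by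
  intro s
  induction s with
  | zero => intro; simp
  | succ s ih =>
    intro hs
    have he := ih (by omega)
    rw [pow_succ', Equiv.Perm.mul_apply, succPerm_apply]
    set e := (succPerm hz ^ s) c
    have h1 : e.1.1 = c.1.1 + s := by rw [he]
    have h2 : e.1.2 = c.1.2 := by rw [he]
    rw [succFun_val_of_ne_none hz e (by rw [h1, h2]; exact h _ (by omega) (by omega)), h1, h2,
      Nat.cast_succ]
    ring_nf

/-! ### A window of climbing chains -/

section Window

variable (hz : IsDelta z) (c : RC z) (F : Finset ℤ) (H : ℕ)
  (hwin : ∀ (s : ℕ) (j : ℤ), s ≤ H → (z (c.1.1 + s, j) = none ↔ j - s ∈ F))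
include hwin

/-- The diagonal coordinate of the curve after `s ≤ H` columns of the window: it has descended
`s` units plus one unit for each chain crossed, and the chains crossed are exactly those of `F`
strictly between the current diagonal coordinate and the starting row.
[cite: GangloffSablik2021, §5.4.2 (arXiv numbering), proof of Prop. 32] -/
theorem succPerm_pow_window_inv (s : ℕ) (hs : s ≤ H) :
    ((succPerm hz ^ s) c).1.2 - s ∉ F ∧
      ((succPerm hz ^ s) c).1.2 =
        c.1.2 - ((F.filter fun r => ((succPerm hz ^ s) c).1.2 - s < r ∧ r < c.1.2).card : ℕ) := by
  induction s with
  | zero =>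
    have h0 : c.1.2 - (0 : ℕ) ∉ F := by
      have := (hwin 0 c.1.2 (Nat.zero_le _)).not.mp (by simpa using c.2)
      simpa using this
    refine ⟨h0, ?_⟩
    have : (F.filter fun r => ((succPerm hz ^ 0) c).1.2 - ((0 : ℕ) : ℤ) < r ∧ r < c.1.2) = ∅ := by
      ext r
      simp only [pow_zero, Equiv.Perm.coe_one, id_eq, Nat.cast_zero, sub_zero, Finset.mem_filter,
        Finset.notMem_empty, iff_false, not_and, not_lt]
      intro _ h
      exact h.le
    rw [this]
    simp
  | succ s ih =>
    obtain ⟨hd, hrow⟩ := ih (by omega)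
    obtain ⟨h1, h2, h3⟩ := succPerm_pow_row_bounds hz c s
    set e := (succPerm hz ^ s) c with he_def
    have hstep : (succPerm hz ^ (s + 1)) c = succFun hz e := by
      rw [pow_succ', Equiv.Perm.mul_apply, succPerm_apply]
    -- the new cell is `→`, so its diagonal coordinate is not in `F`
    have hnew : ((succPerm hz ^ (s + 1)) c).1.2 - ((s + 1 : ℕ) : ℤ) ∉ F := by
      intro hF
      have hcol : ((succPerm hz ^ (s + 1)) c).1.1 = c.1.1 + ((s + 1 : ℕ) : ℤ) :=
        (succPerm_pow_row_bounds hz c (s + 1)).1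
      have := (hwin (s + 1) ((succPerm hz ^ (s + 1)) c).1.2 hs).mpr hF
      rw [← hcol, Prod.mk.eta] at this
      exact ((succPerm hz ^ (s + 1)) c).2 this
    refine ⟨hnew, ?_⟩
    have hs1 : ((s + 1 : ℕ) : ℤ) = s + 1 := by push_cast; ring
    have hcell : (c.1.1 + ((s + 1 : ℕ) : ℤ), e.1.2) = (e.1.1 + 1, e.1.2) := by
      rw [h1, hs1]; ring_nf
    have hwin' : z (e.1.1 + 1, e.1.2) = none ↔ e.1.2 - s - 1 ∈ F := by
      rw [← hcell, hwin (s + 1) e.1.2 hs, hs1, sub_add_eq_sub_sub]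
    by_cases hn : z (e.1.1 + 1, e.1.2) = none
    · -- a chain is crossed: the one with diagonal coordinate `e.row - s - 1`
      have hval := succFun_val_of_eq_none hz e hn
      have hF1 : e.1.2 - s - 1 ∈ F := hwin'.mp hn
      rw [hstep, hval]
      dsimp only
      have hset : (F.filter fun r => e.1.2 - 1 - ((s + 1 : ℕ) : ℤ) < r ∧ r < c.1.2) =
          insert (e.1.2 - s - 1) (F.filter fun r => e.1.2 - s < r ∧ r < c.1.2) := by
        ext r
        simp only [Finset.mem_filter, Finset.mem_insert, hs1]
        constructor
        · rintro ⟨hr, hr1, hr2⟩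
          by_cases hre : r = e.1.2 - s - 1
          · exact Or.inl hre
          · refine Or.inr ⟨hr, ?_, hr2⟩
            have hne : r ≠ e.1.2 - s := fun h => hd (h ▸ hr)
            omega
        · rintro (rfl | ⟨hr, hr1, hr2⟩)
          · exact ⟨hF1, by omega, by omega⟩
          · exact ⟨hr, by omega, hr2⟩
      have hnot : e.1.2 - s - 1 ∉ (F.filter fun r => e.1.2 - s < r ∧ r < c.1.2) := by
        intro h
        simp only [Finset.mem_filter] at h
        omega
      rw [hset, Finset.card_insert_of_notMem hnot]
      push_cast
      omega
    · -- no chain crossed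
      have hval := succFun_val_of_ne_none hz e hn
      have hF1 : e.1.2 - s - 1 ∉ F := fun hF => hn (hwin'.mpr hF)
      rw [hstep, hval]
      dsimp only
      have hset : (F.filter fun r => e.1.2 - ((s + 1 : ℕ) : ℤ) < r ∧ r < c.1.2) =
          (F.filter fun r => e.1.2 - s < r ∧ r < c.1.2) := by
        ext r
        simp only [Finset.mem_filter, hs1]
        constructor
        · rintro ⟨hr, hr1, hr2⟩
          refine ⟨hr, ?_, hr2⟩
          have hne : r ≠ e.1.2 - s := fun h => hd (h ▸ hr)
          have hne' : r ≠ e.1.2 - s - 1 := fun h => hF1 (h ▸ hr)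
          omega
        · rintro ⟨hr, hr1, hr2⟩
          exact ⟨hr, by omega, hr2⟩
      rw [hset, ← hrow]

/-- **Crossing a long enough window of climbing chains, a curve drops by exactly the number of
chains that started below it**: if `H > row(c) - r` for all `r ∈ F`, then after the `H` columns
of the window the curve through `c` is at row `row(c) - #{r ∈ F | r < row(c)}`.
[cite: GangloffSablik2021, §5.4.2 (arXiv numbering), proof of Prop. 32] -/
theorem succPerm_pow_window (hH : ∀ r ∈ F, c.1.2 - r < H) :
    ((succPerm hz ^ H) c).1 = (c.1.1 + H, c.1.2 - ((F.filter fun r => r < c.1.2).card : ℕ)) := by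
  obtain ⟨hd, hrow⟩ := succPerm_pow_window_inv hz c F H hwin H le_rfl
  obtain ⟨h1, h2, h3⟩ := succPerm_pow_row_bounds hz c H
  refine Prod.ext h1 ?_
  rw [hrow]
  congr 3
  ext r
  simp only [Finset.mem_filter, and_congr_right_iff]
  intro hr
  constructor
  · exact fun h => h.2
  · intro h
    exact ⟨by have := hH r hr; omega, h⟩

/-- **Refined crossing count**: the same conclusion when each chain `r` below the curve is
preceded (above it, below the curve) by enough chains that the curve has dropped to its level in
time: `row(c) - r ≤ H + #{r' ∈ F | r < r' < row(c)}`.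
[cite: GangloffSablik2021, §5.4.2 (arXiv numbering), proof of Prop. 32] -/
theorem succPerm_pow_window'
    (hdense : ∀ r ∈ F, r < c.1.2 →
      c.1.2 - r ≤ H + ((F.filter fun r' => r < r' ∧ r' < c.1.2).card : ℕ)) :
    ((succPerm hz ^ H) c).1 = (c.1.1 + H, c.1.2 - ((F.filter fun r => r < c.1.2).card : ℕ)) := by
  obtain ⟨hd, hrow⟩ := succPerm_pow_window_inv hz c F H hwin H le_rfl
  obtain ⟨h1, h2, h3⟩ := succPerm_pow_row_bounds hz c H
  set ρ := ((succPerm hz ^ H) c).1.2 with hρ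
  -- every chain below the curve has been crossed
  have hall : ∀ r ∈ F, r < c.1.2 → ρ - H < r := by
    by_contra hcon
    push Not at hcon
    -- the highest violator
    set V := F.filter fun r => r < c.1.2 ∧ r ≤ ρ - H with hV
    have hVne : V.Nonempty := by
      obtain ⟨r, hr, hr1, hr2⟩ := hcon
      exact ⟨r, by rw [hV, Finset.mem_filter]; exact ⟨hr, hr1, hr2⟩⟩
    set r₀ := V.max' hVne with hr₀
    have hr₀V : r₀ ∈ V := V.max'_mem hVne
    rw [hV, Finset.mem_filter] at hr₀V
    obtain ⟨hr₀F, hr₀c, hr₀le⟩ := hr₀V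
    -- all chains strictly between `r₀` and the start row have been crossed
    have hsub : (F.filter fun r' => r₀ < r' ∧ r' < c.1.2) ⊆
        (F.filter fun r => ρ - H < r ∧ r < c.1.2) := by
      intro r' hr'
      rw [Finset.mem_filter] at hr' ⊢
      refine ⟨hr'.1, ?_, hr'.2.2⟩
      by_contra hle
      have : r' ∈ V := by rw [hV, Finset.mem_filter]; exact ⟨hr'.1, hr'.2.2, not_lt.mp hle⟩
      have := V.le_max' r' this
      rw [← hr₀] at this
      exact absurd hr'.2.1 (not_lt.mpr this)
    have hcard := Finset.card_le_card hsub
    have hden := hdense r₀ hr₀F hr₀c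
    -- so the curve is at most at `r₀ + H`, hence exactly there: contradiction with `hd`
    have hρle : ρ ≤ r₀ + H := by rw [hrow]; omega
    have hρeq : ρ - H = r₀ := by omega
    exact hd (hρeq ▸ hr₀F)
  refine Prod.ext h1 ?_
  show ρ = _
  rw [hrow]
  congr 3
  ext r
  simp only [Finset.mem_filter, and_congr_right_iff]
  intro hr
  exact ⟨fun h => h.2, fun h => ⟨hall r hr h, h⟩⟩

end Window

/-! ### Counting curves in a column -/

open Classical in
/-- The number of `↓`-cells of column `i` strictly between rows `a` and `b`. [folklore] -/
noncomputable def noneCount (z : ℤ × ℤ → Option A) (i a b : ℤ) : ℕ :=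
  ((Finset.Ioo a b).filter fun j => z (i, j) = none).card

/-- [folklore] -/
theorem noneCount_of_le {i a b : ℤ} (h : b ≤ a + 1) : noneCount z i a b = 0 := by
  unfold noneCount
  rw [Finset.card_eq_zero, Finset.filter_eq_empty_iff]
  intro j hj
  simp only [Finset.mem_Ioo] at hj
  omega

/-- [folklore] -/
theorem noneCount_of_eq_none {i a b : ℤ} (h : z (i, a + 1) = none) (hab : a + 1 < b) :
    noneCount z i a b = noneCount z i (a + 1) b + 1 := by
  classical
  unfold noneCount
  have hsplit : ((Finset.Ioo a b).filter fun j => z (i, j) = none) =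
      insert (a + 1) ((Finset.Ioo (a + 1) b).filter fun j => z (i, j) = none) := by
    ext j
    simp only [Finset.mem_filter, Finset.mem_Ioo, Finset.mem_insert]
    constructor
    · rintro ⟨⟨hj1, hj2⟩, hj3⟩
      by_cases hje : j = a + 1
      · exact Or.inl hje
      · exact Or.inr ⟨⟨by omega, hj2⟩, hj3⟩
    · rintro (rfl | ⟨⟨hj1, hj2⟩, hj3⟩)
      · exact ⟨⟨by omega, hab⟩, h⟩
      · exact ⟨⟨by omega, hj2⟩, hj3⟩
  have hnot : a + 1 ∉ ((Finset.Ioo (a + 1) b).filter fun j => z (i, j) = none) := by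
    intro h
    simp only [Finset.mem_filter, Finset.mem_Ioo] at h
    omega
  rw [hsplit, Finset.card_insert_of_notMem hnot]

/-- [folklore] -/
theorem noneCount_of_ne_none {i a b : ℤ} (h : z (i, a + 1) ≠ none) :
    noneCount z i a b = noneCount z i (a + 1) b := by
  classical
  unfold noneCount
  congr 1
  ext j
  simp only [Finset.mem_filter, Finset.mem_Ioo]
  constructor
  · rintro ⟨⟨hj1, hj2⟩, hj3⟩
    refine ⟨⟨?_, hj2⟩, hj3⟩
    have : j ≠ a + 1 := fun h' => h (h' ▸ hj3)
    omega
  · rintro ⟨⟨hj1, hj2⟩, hj3⟩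
    exact ⟨⟨by omega, hj2⟩, hj3⟩

/-- `noneCount` only depends on the `↓`-cells strictly between the two rows. [folklore] -/
theorem noneCount_congr {z' : ℤ × ℤ → Option B} {i a b : ℤ}
    (h : ∀ j : ℤ, a < j → j < b → (z (i, j) = none ↔ z' (i, j) = none)) :
    noneCount z i a b = noneCount z' i a b := by
  classical
  unfold noneCount
  congr 1
  ext j
  simp only [Finset.mem_filter, Finset.mem_Ioo, and_congr_right_iff]
  intro hj
  exact h j hj.1 hj.2

/-- Splitting `noneCount` at a `→`-cell. [folklore] -/
theorem noneCount_split {i a m b : ℤ} (ham : a ≤ m) (hmb : m ≤ b) (hm : z (i, m) ≠ none) :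
    noneCount z i a b = noneCount z i a m + noneCount z i m b := by
  classical
  unfold noneCount
  rw [← Finset.card_union_of_disjoint]
  · congr 1
    ext j
    simp only [Finset.mem_filter, Finset.mem_Ioo, Finset.mem_union]
    constructor
    · rintro ⟨⟨h1, h2⟩, h3⟩
      have : j ≠ m := fun h => hm (h ▸ h3)
      rcases lt_or_gt_of_ne this with h | h
      · exact Or.inl ⟨⟨h1, h⟩, h3⟩
      · exact Or.inr ⟨⟨h, h2⟩, h3⟩
    · rintro (⟨⟨h1, h2⟩, h3⟩ | ⟨⟨h1, h2⟩, h3⟩)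
      · exact ⟨⟨h1, by omega⟩, h3⟩
      · exact ⟨⟨by omega, h2⟩, h3⟩
  · rw [Finset.disjoint_left]
    intro j h1 h2
    simp only [Finset.mem_filter, Finset.mem_Ioo] at h1 h2
    omega

/-- `noneCount` is at most the number of rows strictly between. [folklore] -/
theorem noneCount_le {i a b : ℤ} : (noneCount z i a b : ℤ) ≤ max 0 (b - a - 1) := by
  classical
  unfold noneCount
  have h := Finset.card_filter_le (Finset.Ioo a b) fun j => z (i, j) = none
  rw [Int.card_Ioo] at h
  have : (((b - a - 1).toNat : ℕ) : ℤ) = max 0 (b - a - 1) := by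
    rw [Int.toNat_eq_max]; simp [max_comm]
  omega

/-- No `↓` strictly between: `noneCount = 0`. [folklore] -/
theorem noneCount_eq_zero {i a b : ℤ} (h : ∀ j : ℤ, a < j → j < b → z (i, j) ≠ none) :
    noneCount z i a b = 0 := by
  classical
  unfold noneCount
  rw [Finset.card_eq_zero, Finset.filter_eq_empty_iff]
  intro j hj
  simp only [Finset.mem_Ioo] at hj
  exact h j hj.1 hj.2

/-- `noneCount` of a column whose `↓`-cells between the two rows are an arithmetic progression of
step `2` with `k` terms. [folklore] -/
theorem noneCount_eq_of_progression {i a b h₀ : ℤ} {k : ℕ} (ha : a < h₀) (hb : h₀ + 2 * k ≤ b + 1)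
    (h : ∀ j : ℤ, a < j → j < b → (z (i, j) = none ↔ ∃ l : ℕ, l < k ∧ j = h₀ + 2 * l)) :
    noneCount z i a b = k := by
  classical
  unfold noneCount
  have : ((Finset.Ioo a b).filter fun j => z (i, j) = none) =
      (Finset.range k).image fun l : ℕ => h₀ + 2 * (l : ℤ) := by
    ext j
    simp only [Finset.mem_filter, Finset.mem_Ioo, Finset.mem_image, Finset.mem_range]
    constructor
    · rintro ⟨⟨h1, h2⟩, h3⟩
      obtain ⟨l, hl, rfl⟩ := (h j h1 h2).mp h3
      exact ⟨l, hl, rfl⟩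
    · rintro ⟨l, hl, rfl⟩
      have h1 : a < h₀ + 2 * (l : ℤ) := by omega
      have h2 : h₀ + 2 * (l : ℤ) < b := by omega
      exact ⟨⟨h1, h2⟩, (h _ h1 h2).mpr ⟨l, hl, rfl⟩⟩
  have hinj : Function.Injective fun l : ℕ => h₀ + 2 * (l : ℤ) := by
    intro l l' hl
    simp only at hl
    omega
  rw [this, Finset.card_image_of_injective _ hinj, Finset.card_range]

/-- **The `→`-cell `e` above `c` in its column is `nxtPerm ^ b (c)`, where `b` plus the number of
`↓` strictly between them is the row distance.** [cite: GangloffSablik2021, §5.4.1 (arXiv numbering)] -/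
theorem nxtPerm_pow_eq_of_count (hz : IsDelta z) (c e : RC z) (hcol : e.1.1 = c.1.1)
    (hrow : c.1.2 ≤ e.1.2) :
    ∃ b : ℕ, (nxtPerm hz ^ b) c = e ∧ (b : ℤ) + noneCount z c.1.1 c.1.2 e.1.2 = e.1.2 - c.1.2 := by
  obtain ⟨n, hn⟩ : ∃ n : ℕ, e.1.2 = c.1.2 + n := ⟨(e.1.2 - c.1.2).toNat, by omega⟩
  induction n using Nat.strong_induction_on generalizing c with
  | _ n ih =>
    rcases Nat.eq_zero_or_pos n with rfl | hpos
    · refine ⟨0, ?_, ?_⟩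
      · rw [pow_zero, Equiv.Perm.coe_one, id_eq]
        exact Subtype.ext (Prod.ext hcol.symm (by simp [hn]))
      · rw [noneCount_of_le (by omega)]
        simp [hn]
    · -- go up once from `c`
      set c' := nxtFun hz c with hc'_def
      have hnc : c'.1.1 = c.1.1 := nxtFun_col hz c
      by_cases hnone : z (c.1.1, c.1.2 + 1) = none
      · have hval : c'.1 = (c.1.1, c.1.2 + 1 + 1) := nxtFun_val_of_eq_none hz c hnone
        have hr' : c'.1.2 = c.1.2 + 1 + 1 := by rw [hval]
        -- `e` is not the `↓` at `row + 1`, so `e.row ≥ row + 2`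
        have he2 : c.1.2 + 2 ≤ e.1.2 := by
          by_contra hlt
          have : e.1 = (c.1.1, c.1.2 + 1) := Prod.ext hcol (by omega)
          exact e.2 (by rw [this]; exact hnone)
        obtain ⟨b, hb, hcount⟩ := ih (n - 2) (by omega) c' (by rw [hcol, hnc]) (by omega) (by omega)
        refine ⟨b + 1, by rw [pow_succ, Equiv.Perm.mul_apply, nxtPerm_apply, hb], ?_⟩
        rw [hnc, hr'] at hcount
        rw [noneCount_of_eq_none hnone (by omega), noneCount_of_ne_none]
        · push_cast; omega
        · have := hz.above_ne_none hnone
          exact this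
      · have hval : c'.1 = (c.1.1, c.1.2 + 1) := nxtFun_val_of_ne_none hz c hnone
        have hr' : c'.1.2 = c.1.2 + 1 := by rw [hval]
        obtain ⟨b, hb, hcount⟩ := ih (n - 1) (by omega) c' (by rw [hcol, hnc]) (by omega) (by omega)
        refine ⟨b + 1, by rw [pow_succ, Equiv.Perm.mul_apply, nxtPerm_apply, hb], ?_⟩
        rw [hnc, hr'] at hcount
        rw [noneCount_of_ne_none hnone]
        push_cast; omega

/-- Going up along `nxtPerm` strictly increases the row. [cite: GangloffSablik2021, §5.4.1 (arXiv numbering)] -/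
theorem nxtPerm_zpow_row_lt_aux (hz : IsDelta z) (c : RC z) (m : ℤ) (d : ℕ) :
    ((nxtPerm hz ^ m) c).1.2 < ((nxtPerm hz ^ (m + d + 1)) c).1.2 := by
  induction d with
  | zero =>
    rw [Nat.cast_zero, add_zero, show m + 1 = 1 + m by ring, zpow_one_add, Equiv.Perm.mul_apply,
      nxtPerm_apply]
    rcases nxtFun_row hz ((nxtPerm hz ^ m) c) with h' | h' <;> omega
  | succ d ih =>
    rw [show m + ((d + 1 : ℕ) : ℤ) + 1 = 1 + (m + d + 1) by push_cast; ring, zpow_one_add,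
      Equiv.Perm.mul_apply, nxtPerm_apply]
    rcases nxtFun_row hz ((nxtPerm hz ^ (m + d + 1)) c) with h' | h' <;> omega

/-- [cite: GangloffSablik2021, §5.4.1 (arXiv numbering)] -/
theorem nxtPerm_zpow_row_lt (hz : IsDelta z) (c : RC z) {m m' : ℤ} (h : m < m') :
    ((nxtPerm hz ^ m) c).1.2 < ((nxtPerm hz ^ m') c).1.2 := by
  obtain ⟨d, hd⟩ : ∃ d : ℕ, m' = m + d + 1 := ⟨(m' - m - 1).toNat, by omega⟩
  subst hd
  exact nxtPerm_zpow_row_lt_aux hz c m d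

/-- **Powers of `nxtPerm` at a cell are injective in the exponent.** [cite: GangloffSablik2021, §5.4.1 (arXiv numbering)] -/
theorem nxtPerm_zpow_injective (hz : IsDelta z) (c : RC z) {m m' : ℤ}
    (h : (nxtPerm hz ^ m) c = (nxtPerm hz ^ m') c) : m = m' := by
  by_contra hne
  rcases lt_or_gt_of_ne hne with hlt | hlt
  · have := nxtPerm_zpow_row_lt hz c hlt
    rw [h] at this
    exact lt_irrefl _ this
  · have := nxtPerm_zpow_row_lt hz c hlt
    rw [h] at this
    exact lt_irrefl _ this

end Literature.Dynamics.SymbolicDynamics.Distortion
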